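import Summits.Parity.GeneralizedHardyLittlewood.Theorems.PrimeLevelFamEdgeMomentsBeyondDiagonalDiagRemTwoTwoBoseB
import HarnessLib

/-!
# Route `PrimeLevelFamEdge`, crux K_A `MomentsBeyondDiagonal` (stmt-Parity-20007), line «petersson_layers» v4, stub `stub_diag`:
# **the continued Bose remainder `r₀₀` of ORDER `(2,2)`: two-sequence estimate AND pointwise bounds under ONE constant `E₀₀`**
# (brick B2c of (R₂₂) — the input of the δ-subtraction lemma B1)

The both-sided monomial `P₂(k₁)P₂(k₂)·r₀₀` of the order-`(2,2)` remainder weight is handled (plan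
`Cruxes/MomentsBeyondDiagonal/Lines/petersson_layers_stub_diag_g12_R02_R22.md`, brick B1) by `b = c_nδ₁ + b̃`
(`…DiagRemP2TailHolds.abs_sum_copTauW_primeSq_sub_le`): the pieces `b̃⊗b`, `δ⊗b̃` go through the two-sequence Abel lemma, the
piece `c_n²·δ⊗δ = c_n² log^{i+j}Y·r₀₀(α)` needs POINTWISE bounds on `r₀₀` — with the SAME constant `E₀₀` in
`r₀₀(y) = c₀₀(y) − (log(1/y)/2 + E₀₀)`. This file packages the three facts under one existential:

* `abs_rem00_twoSeq_and_pointwise` — **`∃ E₀₀ C₀ ≥ 0`: (i) the two-sequence estimate for `r₀₀` with the common envelope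
  `9C₀(1+|log 2αY²|)⁶` of `…DiagRemTwoTwoBoseA/B`; (ii) `|r₀₀(y)| ≤ C₀√y` for `0 < y ≤ 1`; (iii) `|r₀₀(y)| ≤ C₀(1 + log y)` for `y ≥ 1`.**

Sources: `…DiagRemBoseTwoSeq.abs_doubleSum_bose_rem_le₂ 0 0`, `…DiagBoseMixedRemainderId.abs_bose_rem_small_le_sqrt 0 0`,
`…DiagBoseMixedTailRem.abs_bose_rem_tail_le 0 0` (KMV form; `μ₀ = 1/4` turns the polynomial part into `L/2`).
Def-free; theorems only. Helper `--supports stmt-Parity-20007`; closes nothing; K_A, K_B and the Parity summit are NOT proved;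
nothing about Landau–Siegel zeros.

## References
* E. Kowalski, P. Michel, J. VanderKam, J. reine angew. Math. 526 (2000), (22)–(28) pp. 12–15 and Prop. 5.1 p. 18.
  [cite: KowalskiMichelVanderKam2000, Prop. 5.1 — derivation (corner of the diagonal, general Q, remainder r₀₀)]
-/

noncomputable section

open Real MeasureTheory Finset

namespace Summit.Parity.GeneralizedHardyLittlewood.Theorems.MomentsBeyondDiagonal.DiagCorner

open Summit.Parity.GeneralizedHardyLittlewood.Theorems.BeyondDiagonalBeatsQuarter.Corner
open Summit.Parity.GeneralizedHardyLittlewood.Theorems.MomentsBeyondDiagonal.DiagLines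

/-- **`r₀₀`: the two-sequence estimate and the pointwise bounds under ONE `E₀₀`** (see the module docstring).
[cite: KowalskiMichelVanderKam2000, Prop. 5.1 — derivation (corner of the diagonal, general Q, remainder r₀₀)] -/
theorem abs_rem00_twoSeq_and_pointwise : ∃ E₀₀ C₀ : ℝ, 0 ≤ C₀ ∧
    (∀ (a₁ a₂ : ℕ → ℝ) (Y α B η : ℝ) (K₁ i j : ℕ), 1 ≤ Y → 0 < α → 1 ≤ i → 1 ≤ j →
      (∀ e : ℕ, e ≤ ⌊Y⌋₊ → |∑ k ∈ Icc 1 e, a₂ k| ≤ B) → (∀ e : ℕ, K₁ ≤ e → |∑ k ∈ Icc 1 e, a₁ k| ≤ η) →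
      2 * α * K₁ * Y ≤ 1 →
    |∑ k₁ ∈ Icc 1 ⌊Y⌋₊, ∑ k₂ ∈ Icc 1 ⌊Y⌋₊,
        a₁ k₁ * a₂ k₂ * ellp Y k₁ ^ i * ellp Y k₂ ^ j *
          ((∫ u₁ in Set.Ioi (0 : ℝ), ∫ u₂ in Set.Ioi ((α * k₁ * k₂) / u₁),
              Real.exp (-(u₁ + u₂)) / (1 - Real.exp (-(u₁ + u₂))) ^ 2) -
            (Real.log (1 / (α * k₁ * k₂)) / 2 + E₀₀))| ≤
      (∑ k ∈ Icc 1 ⌊Y⌋₊, |a₁ k| * ellp Y k ^ i) * (B * (Real.log Y ^ j * (3 * C₀ * Real.sqrt (2 * α * K₁ * Y)))) +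
        (∑ k ∈ Icc 1 ⌊Y⌋₊, |a₂ k| * ellp Y k ^ j) *
          ((2 * η) * (Real.log Y ^ i * (9 * C₀ * (1 + |Real.log (2 * α * Y ^ 2)|) ^ 6)))) ∧
    (∀ y : ℝ, 0 < y → y ≤ 1 →
      |(∫ u₁ in Set.Ioi (0 : ℝ), ∫ u₂ in Set.Ioi (y / u₁), Real.exp (-(u₁ + u₂)) / (1 - Real.exp (-(u₁ + u₂))) ^ 2) -
        (Real.log (1 / y) / 2 + E₀₀)| ≤ C₀ * Real.sqrt y) ∧
    (∀ y : ℝ, 1 ≤ y →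
      |(∫ u₁ in Set.Ioi (0 : ℝ), ∫ u₂ in Set.Ioi (y / u₁), Real.exp (-(u₁ + u₂)) / (1 - Real.exp (-(u₁ + u₂))) ^ 2) -
        (Real.log (1 / y) / 2 + E₀₀)| ≤ C₀ * (1 + Real.log y)) := by
  obtain ⟨C₀₀, hC₀₀, h₀₀⟩ := abs_doubleSum_bose_rem_le₂ 0 0
  obtain ⟨Cs, hs⟩ := abs_bose_rem_small_le_sqrt 0 0
  obtain ⟨Ct, ht⟩ := abs_bose_rem_tail_le 0 0
  set C₀ : ℝ := max (max C₀₀ |Cs|) |Ct| with hC₀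
  have e₀₀ : C₀₀ ≤ C₀ := (le_max_left _ _).trans (le_max_left _ _)
  have es : Cs ≤ C₀ := ((le_abs_self _).trans (le_max_right _ _)).trans (le_max_left _ _)
  have et : Ct ≤ C₀ := (le_abs_self _).trans (le_max_right _ _)
  have hC₀0 : 0 ≤ C₀ := hC₀₀.trans e₀₀
  refine ⟨(∫ u₁ in Set.Ioi (0 : ℝ), Real.log u₁ ^ 0 * ∫ u₂ in Set.Ioi (1 / u₁),
        Real.exp (-(u₁ + u₂)) / (1 - Real.exp (-(u₁ + u₂))) ^ 2 * Real.log u₂ ^ 0) +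
      (∫ η in Set.Ioc (0 : ℝ) 1, (η * (∫ u in Set.Ioi (0 : ℝ), Real.log u ^ 0 * Real.log (η / u) ^ 0 *
            (Real.exp (-(u + η / u)) / (1 - Real.exp (-(u + η / u))) ^ 2) / u) -
          ∫ v in Set.Ioc (0 : ℝ) 1, ((-(Real.log (1 / η) / 2) + Real.log v) ^ 0 * (-(Real.log (1 / η) / 2) - Real.log v) ^ 0 +
              (-(Real.log (1 / η) / 2) - Real.log v) ^ 0 * (-(Real.log (1 / η) / 2) + Real.log v) ^ 0) *
            (v / (1 + v ^ 2) ^ 2)) / η),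
    C₀, hC₀0, fun a₁ a₂ Y α B η K₁ i j hY hα hi hj hB hη hY₁ ↦ ?_, fun y hy0 hy1 ↦ ?_, fun y hy ↦ ?_⟩
  · have hη0 : 0 ≤ η := (abs_nonneg _).trans (hη K₁ le_rfl)
    have hLY : 0 ≤ Real.log Y := Real.log_nonneg hY
    have hx : (1 : ℝ) ≤ 1 + |Real.log (2 * α * Y ^ 2)| := by linarith [abs_nonneg (Real.log (2 * α * Y ^ 2))]
    have hSj : 0 ≤ ∑ k ∈ Icc 1 ⌊Y⌋₊, |a₂ k| * ellp Y k ^ j :=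
      Finset.sum_nonneg fun k _ ↦ mul_nonneg (abs_nonneg _) (pow_nonneg (ellp_nonneg Y k) j)
    have hSi : 0 ≤ ∑ k ∈ Icc 1 ⌊Y⌋₊, |a₁ k| * ellp Y k ^ i :=
      Finset.sum_nonneg fun k _ ↦ mul_nonneg (abs_nonneg _) (pow_nonneg (ellp_nonneg Y k) i)
    have hB0 : 0 ≤ B := (abs_nonneg _).trans (hB 0 (Nat.zero_le _))
    have hsq : 0 ≤ Real.sqrt (2 * α * K₁ * Y) := Real.sqrt_nonneg _
    have h := h₀₀ a₁ a₂ Y α B η K₁ i j hY hα hi hj hB hη hY₁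
    have hfirst :
        (∑ k ∈ Icc 1 ⌊Y⌋₊, |a₁ k| * ellp Y k ^ i) * (B * (Real.log Y ^ j * (3 * C₀₀ * Real.sqrt (2 * α * K₁ * Y)))) ≤
        (∑ k ∈ Icc 1 ⌊Y⌋₊, |a₁ k| * ellp Y k ^ i) * (B * (Real.log Y ^ j * (3 * C₀ * Real.sqrt (2 * α * K₁ * Y)))) := by
      have hLj : 0 ≤ Real.log Y ^ j := pow_nonneg hLY j
      gcongr
    have hsecond :
        (∑ k ∈ Icc 1 ⌊Y⌋₊, |a₂ k| * ellp Y k ^ j) * ((2 * η) * (Real.log Y ^ i *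
            (3 * (C₀₀ + C₀₀ * (1 + |Real.log (2 * α * Y ^ 2)|) ^ (0 + 0 + 1)) + 2 * C₀₀ +
              C₀₀ * (1 + |Real.log (2 * α * Y ^ 2)|) ^ (0 + 0 + 1) * (1 + |Real.log (2 * α * Y ^ 2)|)))) ≤
        (∑ k ∈ Icc 1 ⌊Y⌋₊, |a₂ k| * ellp Y k ^ j) * ((2 * η) * (Real.log Y ^ i *
            (3 * (C₀ + C₀ * (1 + |Real.log (2 * α * Y ^ 2)|) ^ (0 + 0 + 1)) + 2 * C₀ +
              C₀ * (1 + |Real.log (2 * α * Y ^ 2)|) ^ (0 + 0 + 1) * (1 + |Real.log (2 * α * Y ^ 2)|)))) := by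
      have hLi : 0 ≤ Real.log Y ^ i := pow_nonneg hLY i
      have hxN : 0 ≤ (1 + |Real.log (2 * α * Y ^ 2)|) ^ (0 + 0 + 1) := pow_nonneg (by positivity) _
      gcongr
    have h' := le_trans h (add_le_add hfirst hsecond)
    have h'' := weaken_second_term6 hSj hη0 hLY hC₀0 hx (by norm_num : 0 + 0 + 1 ≤ 5) h'
    refine le_trans (le_of_eq ?_) h''
    congr 1
    refine Finset.sum_congr rfl fun k₁ _ ↦ Finset.sum_congr rfl fun k₂ _ ↦ ?_
    simp only [Finset.sum_range_succ, Finset.sum_range_zero, zero_add, add_zero, Nat.choose_self,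
      Nat.cast_one, Nat.sub_self, Nat.cast_zero, Nat.cast_add, pow_zero, pow_one,
      one_mul, mul_one, integral_model_weight_Ioc]
    ring
  · have h := hs y hy0 hy1
    have hs0 : 0 ≤ Real.sqrt y := Real.sqrt_nonneg y
    refine le_trans (le_of_eq ?_) (h.trans (mul_le_mul_of_nonneg_right es hs0))
    congr 1
    simp only [Finset.sum_range_succ, Finset.sum_range_zero, zero_add, add_zero, Nat.choose_self,
      Nat.cast_one, Nat.sub_self, Nat.cast_zero, Nat.cast_add, pow_zero, pow_one,
      one_mul, mul_one, integral_model_weight_Ioc]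
    ring
  · have h := ht y hy
    have hl0 : 0 ≤ 1 + Real.log y := by linarith [Real.log_nonneg hy]
    rw [show (0 + 0 + 1 : ℕ) = 1 from rfl, pow_one] at h
    refine le_trans (le_of_eq ?_) (h.trans (mul_le_mul_of_nonneg_right et hl0))
    congr 1
    simp only [Finset.sum_range_succ, Finset.sum_range_zero, zero_add, add_zero, Nat.choose_self,
      Nat.cast_one, Nat.sub_self, Nat.cast_zero, Nat.cast_add, pow_zero, pow_one,
      one_mul, mul_one, integral_model_weight_Ioc]
    ring

end Summit.Parity.GeneralizedHardyLittlewood.Theorems.MomentsBeyondDiagonal.DiagCorner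

end
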